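import Literature.MathematicalPhysics.QuantumManyBody.WeightedCorrector
import Literature.MathematicalPhysics.QuantumManyBody.PeriodicBoseGasFourier
import Mathlib.Analysis.SpecialFunctions.ExpDeriv
import Mathlib.Analysis.SpecialFunctions.Log.Deriv
import Mathlib.Analysis.Calculus.FDeriv.Mul
import Mathlib.Analysis.Calculus.FDeriv.Pow
import Mathlib.Analysis.Calculus.FDeriv.Pi
import Mathlib.MeasureTheory.Integral.Prod
import Mathlib.MeasureTheory.Constructions.Pi
import Mathlib.MeasureTheory.Integral.Bochner.ContinuousLinearMap
import HarnessLib

/-!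
# The Langevin generator of a positive weight: strong form of the weighted corrector layer

Topic `Literature/MathematicalPhysics/QuantumManyBody`; companion of `WeightedCorrector.lean`
(definition item `defn-WeightedCorrector`: weighted Dirichlet form `dirichletFormW`, `H₋₁` norm
`hMinusOneSqW`, weak correctors `IsWeakCorrector` on the `N`-particle torus). That file is the *weak*
(form) side; this one supplies the *strong* (operator) side which the requesting route items are
phrased in — the informal cruxes `TameNewtonScheme` / `PolicyImprovementIdentity` of route
`BECNewtonPolicyIteration` (summit `AtomisticToContinuum`, sub-problem `BoseEinsteinCondensation`)
speak of "the `μ_n`-symmetric diffusion generator with Dirichlet form `∫|∇φ|² dμ_n` (drift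
`2∇log F_n`)", of the local energy `E_loc = (-ΔF + VF)/F = ΔS - |∇S|² + V` of `F = e^{-S}`, of its
mean `Ē = ⟨E_loc⟩_μ`, and of the exact quadratic remainder `E'_loc = Ē - |∇δ|²` of a Newton
(policy-iteration) step — none of which can be typed from the weak layer alone (no Laplacian on
`Config N = Fin N → ℝ³`, a sup-normed product to which Mathlib's inner-product-space `Laplacian`
does not apply).

* `IsLatticePeriodic L φ` — `Lℤ³`-periodicity in every particle (the second clause of
  `IsPeriodicTest`), with closure under `+, *, -`, post-composition and `pderiv`.
* `configLaplacian φ X = Δφ(X) = ∑ᵢ ∑ₖ ∂_{i,k}∂_{i,k} φ(X)` — the coordinate Laplacian on `(ℝ³)^N`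
  built from `pderiv` (the unit vectors `e_{i,k}` of `kineticDensity`).
* `langevinGen F φ = L_F φ = Δφ + 2∇(log F)·∇φ` — the diffusion generator with carré du champ
  `∇·∇` and reversible measure `F² dX` [BakryGentilLedoux2014, §1.11.3 (1.11.8)–(1.11.10):
  `L = (1/w)∑ ∂ᵢ(w ∂ᵢ ·) = Δ + ∇(log w)·∇ = Δ - ∇W·∇` for `w = e^{-W}`; here `w = F²`]. For
  `F = e^{-S}`: `L_F φ = Δφ - 2∇S·∇φ` (`langevinGen_exp_neg`, no hypotheses).
* `localKinetic S = ΔS - |∇S|²` — the kinetic part of the local energy in logarithmic variables: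
  `Δ(e^{-S}) = -(ΔS - |∇S|²) e^{-S}` (`configLaplacian_exp_neg`), i.e. `-(ΔF)/F = ΔS - |∇S|²`, the
  left side of the stationary Riccati / ergodic Bellman equation `ΔS - |∇S|² + V = E` of the
  logarithmic transform.
* `weightedMean L F g = ⟨g⟩_F = ∫ g F² / ∫ F²` on the fundamental cell, with centring
  `∫ (g - ⟨g⟩_F) F² = 0` and `∫ F² > 0` for a continuous nonvanishing weight.

Main results (all proved):

* **Policy-improvement identity** `localKinetic_add`: for `S, δ ∈ C²`,
  `(Δ - |∇|²)(S + δ) = (Δ - |∇|²)S + L_{e^{-S}} δ - |∇δ|²` pointwise — the Riccati nonlinearity is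
  exactly quadratic; hence under the Newton-step equation `L_{e^{-S}} δ = -(E_loc - E)` the new
  local energy is exactly `E - |∇δ|²` (`localKinetic_add_of_newtonStep`) and `≤ E`
  (`localKinetic_add_le_of_newtonStep`).
* **Integration by parts on the `N`-particle torus** `integral_cellN_pderiv_eq_zero`:
  `∫_{[0,L)^{3N}} ∂_{i,k} G = 0` for `C¹` lattice-periodic `G` (Fubini in particle `i` via
  `MeasurableEquiv.piFinSuccAbove`, then the one-particle `integral_cell_fderiv_eq_zero` of
  `PeriodicBoseGasFourier.lean`).
* **Green's identity** `integral_mul_langevinGen_mul_sq`: `∫ φ (L_F ψ) F² = -𝓔_F(φ, ψ)` for a `C¹`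
  lattice-periodic nonvanishing weight, a periodic test `φ` and a `C²` lattice-periodic `ψ`
  [BakryGentilLedoux2014, (1.11.9)]; consequences: reversibility `∫ φ L_Fψ F² = ∫ ψ L_Fφ F²`,
  invariance `∫ (L_F ψ) F² = 0` / `⟨L_F ψ⟩_F = 0`, and **strong solutions are weak correctors**
  (`IsWeakCorrector.of_langevinGen`: `-L_F δ = g` pointwise with `δ ∈ C²` periodic ⇒
  `IsWeakCorrector L F g δ`, whence `‖g‖²₋₁ = ∫ g δ F²`).
* **Weak correctors with smooth data are strong solutions** `IsWeakCorrector.neg_langevinGen_eq`: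
  for `F ∈ C²` lattice periodic nonvanishing, `δ ∈ C³`, `g ∈ C¹` lattice periodic, a weak corrector
  satisfies `-L_F δ = g` on the fundamental cell `[0,L)^{3N}` (the residual `L_F δ + g` is then a
  periodic test function orthogonal to itself in `L²(F² dX)`, `IsWeakCorrector.integral_mul_residual_
  mul_sq`; positivity of Lebesgue measure on open sets gives the open box, continuity the faces).
  So for smooth data the weak Poisson equation of `WeightedCorrector.lean` and the pointwise
  Newton-step equation of `localKinetic_add_of_newtonStep` are interchangeable.

## Design choices

* Everything is unbundled and real-valued, in the conventions of `WeightedCorrector.lean`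
  (`pderiv`, `gradDot`, real Bochner integrals on `cellN N L`, unnormalised `F² dX`); `F` enters the
  generator through `log F`, so statements needing the chain rule carry `F X ≠ 0` (positivity is not
  needed for the algebra), and the `e^{-S}` forms carry no hypothesis at all (`log ∘ exp = id`).
* `C²` hypotheses are global `ContDiff ℝ 2` (the requesters' "C² data"); pointwise versions would
  only need twice-differentiability at `X` but are not what the items use.
* `C²`/`C³` smoothness in the weak-⇒-strong direction is what makes the residual an admissible test
  function; the minimal-regularity statement (density of the `C¹` periodic core in `L²` of the
  cell) is not attempted. Also not here (deliberately): existence of correctors, extension of the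
  cell statement to all of `(ℝ³)^N` by lattice reduction (`cellIndex`/`latticeVecN` live in
  `BoseGasThermodynamicLimitProofs.lean`, not imported to keep this file light), Barta's inequality
  and the Rayleigh-quotient bracket of `PolicyImprovementIdentity` (ii)–(iii) (problem-side
  statements about `periodicEnergy`), and any potential `V` (an arbitrary real function in the
  Newton-step lemmas; the route takes `V = periodicInteraction v L`, `ℝ≥0∞`-valued, and converts).
* Mathlib: `Laplacian`/`Δ` exist for inner-product spaces only (`Mathlib.Analysis.InnerProductSpace.
  Laplacian`); no diffusion generators or Dirichlet forms (searched `DirichletForm`, `carreDuChamp`,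
  `generator`); `fderiv`, `ContDiff`, `MeasurableEquiv.piFinSuccAbove`,
  `volume_preserving_piFinSuccAbove`, `integral_prod_symm`, `hasFDerivAt_single` are Mathlib's.

## References

* [BakryGentilLedoux2014] D. Bakry, I. Gentil, M. Ledoux, *Analysis and Geometry of Markov
  Diffusion Operators*, Grundlehren 348, Springer 2014: §1.11.3 "Reversible measures of
  differential operators", (1.11.8) `Lf = (1/w)∑ ∂ᵢ(w gⁱʲ ∂ⱼ f)`, (1.11.9)
  `∫ f Lg dμ = -∫ Γ(f,g) dμ`, (1.11.10) `L = Δ_g - ∇W·∇`.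
* [KipnisLandim1999] C. Kipnis, C. Landim, *Scaling Limits of Interacting Particle Systems*,
  Springer 1999: App. 1 §6 (the `H₋₁` norm; `‖Sf‖₋₁ = ‖f‖₁`).
* Context (not cited for statements): C. J. Holland, CPAM 31 (1978) 509 (minimum principle for the
  principal eigenvalue via the logarithmic transformation); M. L. Puterman, S. L. Brumelle, Math.
  Oper. Res. 4 (1979) 60 (policy iteration = Newton–Kantorovich).
-/

noncomputable section

open MeasureTheory Metric
open scoped ENNReal NNReal

namespace Literature.MathematicalPhysics.QuantumManyBody.BoseGas

variable {N : ℕ}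

/-! ### Lattice periodicity -/

/-- `Lℤ³`-periodicity of a function on `(ℝ³)^N` in every particle coordinate, stated on the
generators `L e_{i,k}` of the period lattice (the second clause of `IsPeriodicTest`). [folklore] -/
def IsLatticePeriodic (L : ℝ) (φ : Config N → ℝ) : Prop :=
  ∀ (X : Config N) (i : Fin N) (k : Fin 3), φ (X + Pi.single i (EuclideanSpace.single k L)) = φ X

namespace IsLatticePeriodic

variable {L : ℝ} {φ ψ : Config N → ℝ}

/-- A periodic test function is lattice periodic. [folklore] -/
theorem _root_.Literature.MathematicalPhysics.QuantumManyBody.BoseGas.IsPeriodicTest.isLatticePeriodic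
    (h : IsPeriodicTest L φ) : IsLatticePeriodic L φ := h.2

/-- A `C¹` lattice-periodic function is a periodic test function. [folklore] -/
theorem isPeriodicTest (h : IsLatticePeriodic L φ) (hφ : ContDiff ℝ 1 φ) : IsPeriodicTest L φ :=
  ⟨hφ, h⟩

/-- Constants are lattice periodic. [folklore] -/
theorem const (L c : ℝ) : IsLatticePeriodic L (fun _ : Config N => c) := fun _ _ _ => rfl

/-- Sums of lattice-periodic functions are lattice periodic. [folklore] -/
theorem add (hφ : IsLatticePeriodic L φ) (hψ : IsLatticePeriodic L ψ) :
    IsLatticePeriodic L (φ + ψ) := fun X i k => by simp only [Pi.add_apply, hφ X i k, hψ X i k]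

/-- Products of lattice-periodic functions are lattice periodic. [folklore] -/
theorem mul (hφ : IsLatticePeriodic L φ) (hψ : IsLatticePeriodic L ψ) :
    IsLatticePeriodic L (φ * ψ) := fun X i k => by simp only [Pi.mul_apply, hφ X i k, hψ X i k]

/-- Negatives of lattice-periodic functions are lattice periodic. [folklore] -/
theorem neg (hφ : IsLatticePeriodic L φ) : IsLatticePeriodic L (-φ) := fun X i k => by
  simp only [Pi.neg_apply, hφ X i k]

/-- Post-composition preserves lattice periodicity (e.g. `F = exp ∘ (-S)`). [folklore] -/
theorem comp (hφ : IsLatticePeriodic L φ) (f : ℝ → ℝ) : IsLatticePeriodic L (fun X => f (φ X)) :=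
  fun X i k => by simp only [hφ X i k]

/-- **Partial derivatives of periodic functions are periodic**: `∂_{i,k}φ (X + L e_{j,l}) =
∂_{i,k}φ (X)` (differentiate the identity `φ(· + L e_{j,l}) = φ`). [folklore] -/
theorem pderiv (hφ : IsLatticePeriodic L φ) (i : Fin N) (k : Fin 3) :
    IsLatticePeriodic L (pderiv i k φ) := by
  intro X j l
  have h : (fun Y => φ (Y + Pi.single j (EuclideanSpace.single l L))) = φ := funext fun Y => hφ Y j l
  unfold BoseGas.pderiv
  rw [← fderiv_comp_add_right, h]

end IsLatticePeriodic

/-! ### More calculus of `pderiv` and `gradDot` -/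

section Calculus

variable {φ ψ F S : Config N → ℝ} {X : Config N}

/-- `∂_{i,k}(-φ) = -∂_{i,k}φ` (no differentiability needed). [folklore] -/
@[simp]
theorem pderiv_fun_neg (φ : Config N → ℝ) (X : Config N) (i : Fin N) (k : Fin 3) :
    pderiv i k (fun Y => -φ Y) X = -pderiv i k φ X := by
  simp [pderiv]

/-- Product rule `∂_{i,k}(φψ) = φ ∂_{i,k}ψ + ψ ∂_{i,k}φ` at points of differentiability. [folklore] -/
theorem pderiv_fun_mul (hφ : DifferentiableAt ℝ φ X) (hψ : DifferentiableAt ℝ ψ X) (i : Fin N)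
    (k : Fin 3) :
    pderiv i k (fun Y => φ Y * ψ Y) X = φ X * pderiv i k ψ X + ψ X * pderiv i k φ X := by
  simp only [pderiv, fderiv_fun_mul hφ hψ]
  rfl

/-- `∂_{i,k}(F²) = 2 F ∂_{i,k}F` at points of differentiability. [folklore] -/
theorem pderiv_fun_sq (hF : DifferentiableAt ℝ F X) (i : Fin N) (k : Fin 3) :
    pderiv i k (fun Y => F Y ^ 2) X = 2 * F X * pderiv i k F X := by
  have h : (fun Y => F Y ^ 2) = fun Y => F Y * F Y := funext fun Y => sq (F Y)
  rw [h, pderiv_fun_mul hF hF]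
  ring

/-- Chain rule `∂_{i,k} e^{-S} = -(∂_{i,k}S) e^{-S}` at points of differentiability. [folklore] -/
theorem pderiv_exp_neg (hS : DifferentiableAt ℝ S X) (i : Fin N) (k : Fin 3) :
    pderiv i k (fun Y => Real.exp (-S Y)) X = -pderiv i k S X * Real.exp (-S X) := by
  rw [pderiv, pderiv, (hS.hasFDerivAt.fun_neg.exp).fderiv]
  show Real.exp (-S X) * -(fderiv ℝ S X (Pi.single i (EuclideanSpace.single k 1))) = _
  ring

/-- Chain rule `∂_{i,k} log F = (∂_{i,k}F)/F` where `F ≠ 0` is differentiable. [folklore] -/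
theorem pderiv_log (hF : DifferentiableAt ℝ F X) (h0 : F X ≠ 0) (i : Fin N) (k : Fin 3) :
    pderiv i k (fun Y => Real.log (F Y)) X = (F X)⁻¹ * pderiv i k F X := by
  rw [pderiv, pderiv, fderiv.log hF h0]
  rfl

/-- `∇(log F)·∇ψ = F⁻¹ ∇F·∇ψ` where `F ≠ 0` is differentiable. [folklore] -/
theorem gradDot_log (hF : DifferentiableAt ℝ F X) (h0 : F X ≠ 0) (ψ : Config N → ℝ) :
    gradDot (fun Y => Real.log (F Y)) ψ X = (F X)⁻¹ * gradDot F ψ X := by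
  simp only [gradDot, pderiv_log hF h0, Finset.mul_sum, mul_assoc]

/-- `∇(log e^{-S})·∇ψ = -∇S·∇ψ` (no hypotheses: `log ∘ exp = id`). [folklore] -/
theorem gradDot_log_exp_neg (S ψ : Config N → ℝ) (X : Config N) :
    gradDot (fun Y => Real.log (Real.exp (-S Y))) ψ X = -gradDot S ψ X := by
  simp only [Real.log_exp, gradDot, pderiv_fun_neg, neg_mul, Finset.sum_neg_distrib]

/-- `Γ(φ₁ + φ₂, ψ) = Γ(φ₁, ψ) + Γ(φ₂, ψ)` at points of differentiability. [folklore] -/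
theorem gradDot_add_left {φ₁ φ₂ : Config N → ℝ} (hφ₁ : DifferentiableAt ℝ φ₁ X)
    (hφ₂ : DifferentiableAt ℝ φ₂ X) (ψ : Config N → ℝ) :
    gradDot (φ₁ + φ₂) ψ X = gradDot φ₁ ψ X + gradDot φ₂ ψ X := by
  simp only [gradDot, pderiv_add hφ₁ hφ₂, add_mul, Finset.sum_add_distrib]

/-- Polarisation: `|∇(φ + ψ)|² = |∇φ|² + 2 ∇φ·∇ψ + |∇ψ|²` at points of differentiability.
[folklore] -/
theorem gradDot_add_add (hφ : DifferentiableAt ℝ φ X) (hψ : DifferentiableAt ℝ ψ X) :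
    gradDot (φ + ψ) (φ + ψ) X = gradDot φ φ X + 2 * gradDot φ ψ X + gradDot ψ ψ X := by
  rw [gradDot_add_left hφ hψ, gradDot_comm φ (φ + ψ), gradDot_comm ψ (φ + ψ),
    gradDot_add_left hφ hψ, gradDot_add_left hφ hψ, gradDot_comm ψ φ]
  ring

/-- For `φ ∈ C^{n+1}`, `∂_{i,k}φ ∈ C^n`. [folklore] -/
theorem contDiff_pderiv {n : WithTop ℕ∞} (hφ : ContDiff ℝ (n + 1) φ) (i : Fin N) (k : Fin 3) :
    ContDiff ℝ n (pderiv i k φ) :=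
  (hφ.fderiv_right le_rfl).clm_apply contDiff_const

/-- For `φ ∈ C²`, `∂_{i,k}φ ∈ C¹`. [folklore] -/
theorem contDiff_one_pderiv (hφ : ContDiff ℝ 2 φ) (i : Fin N) (k : Fin 3) :
    ContDiff ℝ 1 (pderiv i k φ) :=
  (hφ.fderiv_right (m := 1) (by norm_num)).clm_apply contDiff_const

/-- For `φ ∈ C²`, `∂_{i,k}φ` is differentiable. [folklore] -/
theorem differentiable_pderiv (hφ : ContDiff ℝ 2 φ) (i : Fin N) (k : Fin 3) :
    Differentiable ℝ (pderiv i k φ) :=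
  (contDiff_one_pderiv hφ i k).differentiable (by simp)

end Calculus

/-! ### The coordinate Laplacian and the Langevin generator -/

section Generator

variable {φ ψ F S δ : Config N → ℝ} {X : Config N}

/-- The **coordinate Laplacian** `Δφ(X) = ∑ᵢ ∑ₖ ∂²φ/∂x_{i,k}²(X)` on `(ℝ³)^N` (iterated coordinate
partial derivatives along the unit vectors `e_{i,k}` of `kineticDensity`/`pderiv`; `Config N` is the
sup-normed product `Fin N → ℝ³`, not an inner-product space, so Mathlib's `Laplacian` does not
apply verbatim). [cite: BakryGentilLedoux2014, §1.11.3 (1.11.8) with w = 1, g = id] -/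
def configLaplacian (φ : Config N → ℝ) (X : Config N) : ℝ :=
  ∑ i : Fin N, ∑ k : Fin 3, pderiv i k (pderiv i k φ) X

/-- The **Langevin generator of the weight `F`**: `L_F φ = Δφ + 2 ∇(log F)·∇φ`, the diffusion
operator with carré du champ `∇·∇` and reversible measure `μ_F = F² dX` (Bakry–Gentil–Ledoux
(1.11.8)–(1.11.10) with `g^{ij} = δ^{ij}`, density `w = F² = e^{-W}`, `W = -2 log F`:
`L = Δ + ∇(log w)·∇ = Δ - ∇W·∇`), i.e. the ground-state transform `φ ↦ F⁻¹(Δ - (ΔF)/F)(Fφ)` of the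
Schrödinger operator `-Δ + (ΔF)/F` up to sign. For `F = e^{-S}`: `L_F φ = Δφ - 2∇S·∇φ`
(`langevinGen_exp_neg`). Its Dirichlet form on the torus is `dirichletFormW`:
`∫ φ (L_F ψ) F² = -𝓔_F(φ, ψ)` (`integral_mul_langevinGen_mul_sq`, BGL (1.11.9)).
[cite: BakryGentilLedoux2014, §1.11.3 (1.11.8)–(1.11.10)] -/
def langevinGen (F φ : Config N → ℝ) (X : Config N) : ℝ :=
  configLaplacian φ X + 2 * gradDot (fun Y => Real.log (F Y)) φ X

/-- The **local kinetic energy in logarithmic variables**: `ΔS - |∇S|²`, which is `-(ΔF)/F` for the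
positive function `F = e^{-S}` (`configLaplacian_exp_neg`: the Riccati / Hopf–Cole form of the
kinetic term, so that the local energy of the trial function `F` is `(-ΔF + VF)/F = ΔS - |∇S|² + V`,
the left side of the stationary Riccati–HJB equation `ΔS - |∇S|² + V = E` of the logarithmic
transform). [folklore] -/
def localKinetic (S : Config N → ℝ) (X : Config N) : ℝ :=
  configLaplacian S X - gradDot S S X

/-- The **`μ_F`-mean** `⟨g⟩_F = ∫_{[0,L)^{3N}} g F² dX / ∫_{[0,L)^{3N}} F² dX` of an observable with
respect to the normalised weight `F² dX / ∫ F²` on the fundamental cell (junk value when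
`∫ F² = 0`). [folklore] -/
def weightedMean (L : ℝ) (F g : Config N → ℝ) : ℝ :=
  (∫ X in cellN N L, g X * F X ^ 2) / ∫ X in cellN N L, F X ^ 2

/-- Unfolding `Δ`. [folklore] -/
theorem configLaplacian_def (φ : Config N → ℝ) (X : Config N) :
    configLaplacian φ X = ∑ i : Fin N, ∑ k : Fin 3, pderiv i k (pderiv i k φ) X := rfl

/-- `Δ c = 0`. [folklore] -/
@[simp]
theorem configLaplacian_const (c : ℝ) (X : Config N) : configLaplacian (fun _ : Config N => c) X = 0 := by
  have h : ∀ (i : Fin N) (k : Fin 3), pderiv i k (fun _ : Config N => c) = fun _ => 0 :=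
    fun i k => funext fun Y => pderiv_const c Y i k
  simp [configLaplacian, h]

/-- `Δ(c φ) = c Δφ` (no differentiability needed over a field). [folklore] -/
theorem configLaplacian_smul (c : ℝ) (φ : Config N → ℝ) (X : Config N) :
    configLaplacian (c • φ) X = c * configLaplacian φ X := by
  have h : ∀ (i : Fin N) (k : Fin 3), pderiv i k (c • φ) = c • pderiv i k φ :=
    fun i k => funext fun Y => by rw [pderiv_const_smul, Pi.smul_apply, smul_eq_mul]
  simp only [configLaplacian, h, pderiv_const_smul, Finset.mul_sum]

/-- `Δ(φ + ψ) = Δφ + Δψ` for `C²` functions. [folklore] -/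
theorem configLaplacian_add (hφ : ContDiff ℝ 2 φ) (hψ : ContDiff ℝ 2 ψ) (X : Config N) :
    configLaplacian (φ + ψ) X = configLaplacian φ X + configLaplacian ψ X := by
  have hφd : Differentiable ℝ φ := hφ.differentiable (by simp)
  have hψd : Differentiable ℝ ψ := hψ.differentiable (by simp)
  have h : ∀ (i : Fin N) (k : Fin 3), pderiv i k (φ + ψ) = pderiv i k φ + pderiv i k ψ :=
    fun i k => funext fun Y => pderiv_add (hφd Y) (hψd Y) i k
  simp only [configLaplacian, h, ← Finset.sum_add_distrib]
  refine Finset.sum_congr rfl fun i _ => Finset.sum_congr rfl fun k _ => ?_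
  exact pderiv_add (differentiable_pderiv hφ i k X) (differentiable_pderiv hψ i k X) i k

/-- For a constant weight the generator is the Laplacian: `L_c φ = Δφ`. [folklore] -/
@[simp]
theorem langevinGen_const_weight (c : ℝ) (φ : Config N → ℝ) (X : Config N) :
    langevinGen (fun _ : Config N => c) φ X = configLaplacian φ X := by
  simp [langevinGen]

/-- The generator annihilates constants: `L_F c = 0`. [folklore] -/
@[simp]
theorem langevinGen_const (F : Config N → ℝ) (c : ℝ) (X : Config N) :
    langevinGen F (fun _ : Config N => c) X = 0 := by
  simp [langevinGen]

/-- **The generator in logarithmic variables**: for `F = e^{-S}`,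
`L_F φ = Δφ - 2 ∇S·∇φ` (drift `2∇log F = -2∇S`; no hypotheses). [cite: BakryGentilLedoux2014, §1.11.3 (1.11.10)] -/
theorem langevinGen_exp_neg (S φ : Config N → ℝ) (X : Config N) :
    langevinGen (fun Y => Real.exp (-S Y)) φ X = configLaplacian φ X - 2 * gradDot S φ X := by
  rw [langevinGen, gradDot_log_exp_neg]
  ring

/-- With `F ≠ 0` differentiable at `X`: `L_F φ = Δφ + (2/F) ∇F·∇φ`. [cite: BakryGentilLedoux2014, §1.11.3 (1.11.8)] -/
theorem langevinGen_eq_div (hF : DifferentiableAt ℝ F X) (h0 : F X ≠ 0) (φ : Config N → ℝ) :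
    langevinGen F φ X = configLaplacian φ X + 2 / F X * gradDot F φ X := by
  rw [langevinGen, gradDot_log hF h0, div_eq_mul_inv, mul_assoc]

/-- **Riccati identity** (logarithmic transform of the kinetic energy): for `S ∈ C²` and
`F = e^{-S}`, `ΔF = -(ΔS - |∇S|²) F`, i.e. `-(ΔF)/F = ΔS - |∇S|²`. [folklore] -/
theorem configLaplacian_exp_neg (hS : ContDiff ℝ 2 S) (X : Config N) :
    configLaplacian (fun Y => Real.exp (-S Y)) X = -localKinetic S X * Real.exp (-S X) := by
  have hSd : Differentiable ℝ S := hS.differentiable (by simp)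
  have hFd : Differentiable ℝ (fun Y => Real.exp (-S Y)) := fun Y => (hSd Y).fun_neg.exp
  -- first derivatives
  have h1 : ∀ (i : Fin N) (k : Fin 3), pderiv i k (fun Y => Real.exp (-S Y)) =
      fun Y => (-pderiv i k S Y) * Real.exp (-S Y) :=
    fun i k => funext fun Y => pderiv_exp_neg (hSd Y) i k
  -- second derivatives
  have h2 : ∀ (i : Fin N) (k : Fin 3), pderiv i k (pderiv i k (fun Y => Real.exp (-S Y))) X =
      (pderiv i k S X * pderiv i k S X - pderiv i k (pderiv i k S) X) * Real.exp (-S X) := by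
    intro i k
    rw [h1, pderiv_fun_mul ((differentiable_pderiv hS i k X).fun_neg) (hFd X), pderiv_fun_neg,
      pderiv_exp_neg (hSd X)]
    ring
  simp only [configLaplacian, h2, localKinetic, gradDot, ← Finset.sum_mul, Finset.sum_sub_distrib]
  ring

/-- The same identity solved for the local kinetic energy: `-(Δ e^{-S})/e^{-S} = ΔS - |∇S|²`.
[folklore] -/
theorem localKinetic_eq_neg_div (hS : ContDiff ℝ 2 S) (X : Config N) :
    localKinetic S X = -configLaplacian (fun Y => Real.exp (-S Y)) X / Real.exp (-S X) := by
  rw [configLaplacian_exp_neg hS, neg_mul, neg_neg, mul_div_assoc, div_self (Real.exp_pos _).ne',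
    mul_one]

/-- **Policy-improvement (Newton-step) identity, pointwise.** For `S, δ ∈ C²` the Riccati
nonlinearity is exactly quadratic:
`(Δ - |∇|²)(S + δ) = (Δ - |∇|²)S + (Δδ - 2∇S·∇δ) - |∇δ|²`, where `Δδ - 2∇S·∇δ = L_{e^{-S}} δ` is
the Langevin generator of the current iterate acting on the correction: the new local energy is the
old one, plus the linearisation, minus `|∇δ|²` — no higher-order terms (Howard policy improvement
= Newton–Kantorovich for the ergodic Bellman/Riccati equation). [folklore] -/
theorem localKinetic_add (hS : ContDiff ℝ 2 S) (hδ : ContDiff ℝ 2 δ) (X : Config N) :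
    localKinetic (S + δ) X =
      localKinetic S X + langevinGen (fun Y => Real.exp (-S Y)) δ X - gradDot δ δ X := by
  have hSd : Differentiable ℝ S := hS.differentiable (by simp)
  have hδd : Differentiable ℝ δ := hδ.differentiable (by simp)
  rw [localKinetic, localKinetic, langevinGen_exp_neg, configLaplacian_add hS hδ,
    gradDot_add_add (hSd X) (hδd X)]
  ring

/-- **Exact quadratic remainder of the Newton step.** If the correction `δ` solves the linearised
(Poisson) equation `L_{e^{-S}} δ = -(E_loc - E)` at `X`, where `E_loc = ΔS - |∇S|² + V` is the
local energy of `e^{-S}` for a potential `V` and `E` a constant (in the scheme: the current mean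
energy), then the local energy of the improved trial function `e^{-(S+δ)}` at `X` is EXACTLY
`E - |∇δ(X)|²`. [folklore] -/
theorem localKinetic_add_of_newtonStep (hS : ContDiff ℝ 2 S) (hδ : ContDiff ℝ 2 δ)
    {V : Config N → ℝ} {E : ℝ}
    (h : langevinGen (fun Y => Real.exp (-S Y)) δ X = -(localKinetic S X + V X - E)) :
    localKinetic (S + δ) X + V X = E - gradDot δ δ X := by
  rw [localKinetic_add hS hδ, h]
  ring

/-- The improved local energy never exceeds `E`: `(Δ - |∇|²)(S + δ) + V ≤ E` pointwise under the
Newton-step equation (since `|∇δ|² ≥ 0`); with Barta's inequality this is the upper half of the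
energy bracket. [folklore] -/
theorem localKinetic_add_le_of_newtonStep (hS : ContDiff ℝ 2 S) (hδ : ContDiff ℝ 2 δ)
    {V : Config N → ℝ} {E : ℝ}
    (h : langevinGen (fun Y => Real.exp (-S Y)) δ X = -(localKinetic S X + V X - E)) :
    localKinetic (S + δ) X + V X ≤ E := by
  rw [localKinetic_add_of_newtonStep hS hδ h]
  linarith [gradDot_self_nonneg δ X]

end Generator

/-! ### The weighted mean -/

section Mean

variable {L : ℝ} {F g : Config N → ℝ}

/-- `⟨c⟩_F = c` when `∫ F² ≠ 0`. [folklore] -/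
theorem weightedMean_const (hZ : (∫ X in cellN N L, F X ^ 2) ≠ 0) (c : ℝ) :
    weightedMean L F (fun _ => c) = c := by
  rw [weightedMean, integral_const_mul, mul_div_assoc, div_self hZ, mul_one]

/-- **Centring**: `∫ (g - ⟨g⟩_F) F² dX = 0` when `∫ F² ≠ 0` — the observable `g - ⟨g⟩_F` is the one
whose `H₋₁` norm / corrector is meaningful (`hMinusOneSqW_eq_top`,
`IsWeakCorrector.integral_mul_sq_eq_zero`). [folklore] -/
theorem integral_sub_weightedMean_mul_sq (hZ : (∫ X in cellN N L, F X ^ 2) ≠ 0)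
    (hg : IntegrableOn (fun X => g X * F X ^ 2) (cellN N L) volume)
    (hF : IntegrableOn (fun X => F X ^ 2) (cellN N L) volume) :
    ∫ X in cellN N L, (g X - weightedMean L F g) * F X ^ 2 = 0 := by
  simp_rw [sub_mul]
  rw [integral_sub hg (hF.const_mul _), integral_const_mul, weightedMean, div_mul_cancel₀ _ hZ,
    sub_self]

/-- A continuous nonvanishing weight on a cell of positive side has `∫_{[0,L)^{3N}} F² dX > 0`, so
`weightedMean L F` carries no junk value. [folklore] -/
theorem integral_sq_pos (hL : 0 < L) (hF : Continuous F) (h0 : ∀ X, F X ≠ 0) :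
    0 < ∫ X in cellN N L, F X ^ 2 := by
  have hint : IntegrableOn (fun X => F X ^ 2) (cellN N L) volume := integrableOn_cellN (hF.pow 2) L
  rw [integral_pos_iff_support_of_nonneg_ae (Filter.Eventually.of_forall fun X => sq_nonneg (F X))
    hint]
  have hsupp : Function.support (fun X => F X ^ 2) = Set.univ :=
    Set.eq_univ_of_forall fun X => by simpa [Function.mem_support] using h0 X
  rw [hsupp, Measure.restrict_apply_univ, volume_cellN]
  exact ENNReal.pow_pos (ENNReal.pow_pos (ENNReal.ofReal_pos.2 hL) 3) N

end Mean

/-! ### Integration by parts on the `N`-particle torus -/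

section Torus

variable {L : ℝ}

/-- `insertNth i (x + v) Y = insertNth i x Y + eᵢ ⊗ v`: moving particle `i` is adding `Pi.single i v`.
[folklore] -/
theorem insertNth_add_eq {n : ℕ} (i : Fin (n + 1)) (x v : Space) (Y : Fin n → Space) :
    (Fin.insertNth (α := fun _ => Space) i (x + v) Y : Config (n + 1)) =
      Fin.insertNth (α := fun _ => Space) i x Y + Pi.single i v := by
  funext j
  rcases Fin.eq_self_or_eq_succAbove i j with rfl | ⟨j', rfl⟩
  · simp [Fin.insertNth_apply_same]
  · simp [Fin.insertNth_apply_succAbove, Fin.succAbove_ne]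

/-- The embedding `ContinuousLinearMap.pi (Pi.single i id)` is `v ↦ Pi.single i v`. [folklore] -/
theorem pi_single_id_apply (i : Fin N) (v : Space) :
    (ContinuousLinearMap.pi (Pi.single i (ContinuousLinearMap.id ℝ Space)) : Space →L[ℝ] Config N) v
      = Pi.single i v := by
  funext j
  rw [ContinuousLinearMap.pi_apply]
  rcases eq_or_ne j i with rfl | hj
  · simp
  · simp [hj]

/-- The slice map `x ↦ insertNth i x Y` has derivative `v ↦ Pi.single i v`. [folklore] -/
theorem hasFDerivAt_insertNth {n : ℕ} (i : Fin (n + 1)) (Y : Fin n → Space) (x : Space) :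
    HasFDerivAt (fun y : Space => (Fin.insertNth (α := fun _ => Space) i y Y : Config (n + 1)))
      (ContinuousLinearMap.pi (Pi.single i (ContinuousLinearMap.id ℝ Space))) x := by
  have h : (fun y : Space => (Fin.insertNth (α := fun _ => Space) i y Y : Config (n + 1))) =
      fun y => Fin.insertNth (α := fun _ => Space) i 0 Y + Pi.single i y := by
    funext y
    rw [← insertNth_add_eq, zero_add]
  rw [h]
  exact (hasFDerivAt_single (𝕜 := ℝ) (E := fun _ : Fin (n + 1) => Space) (i := i) x).const_add _

/-- The slice map is smooth (affine). [folklore] -/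
theorem contDiff_insertNth {n : ℕ} (i : Fin (n + 1)) (Y : Fin n → Space) {m : WithTop ℕ∞} :
    ContDiff ℝ m (fun y : Space => (Fin.insertNth (α := fun _ => Space) i y Y : Config (n + 1))) := by
  have h : (fun y : Space => (Fin.insertNth (α := fun _ => Space) i y Y : Config (n + 1))) =
      fun y => Fin.insertNth (α := fun _ => Space) i 0 Y +
        (ContinuousLinearMap.pi (Pi.single i (ContinuousLinearMap.id ℝ Space)) : Space →L[ℝ] _) y := by
    funext y
    rw [pi_single_id_apply, ← insertNth_add_eq, zero_add]
  rw [h]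
  exact contDiff_const.add (ContinuousLinearMap.contDiff _)

/-- Chain rule for slices: the `e_k`-derivative of `x ↦ G(insertNth i x Y)` is `∂_{i,k}G` at the
inserted configuration. [folklore] -/
theorem fderiv_slice_apply {n : ℕ} {G : Config (n + 1) → ℝ} (hG : Differentiable ℝ G)
    (i : Fin (n + 1)) (k : Fin 3) (Y : Fin n → Space) (x : Space) :
    fderiv ℝ (fun y : Space => G (Fin.insertNth (α := fun _ => Space) i y Y)) x
        (EuclideanSpace.single k 1) =
      pderiv i k G (Fin.insertNth (α := fun _ => Space) i x Y) := by
  have h := ((hG _).hasFDerivAt.comp x (hasFDerivAt_insertNth i Y x)).fderiv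
  rw [show (fun y : Space => G (Fin.insertNth (α := fun _ => Space) i y Y)) =
      G ∘ fun y : Space => (Fin.insertNth (α := fun _ => Space) i y Y : Config (n + 1)) from rfl, h,
    ContinuousLinearMap.comp_apply, pi_single_id_apply]
  rfl

/-- Real-valued form of `integral_cell_fderiv_eq_zero`: `∫_{[0,L)³} ∂ⱼ g = 0` for a `C¹`
`Lℤ³`-periodic real `g` on `ℝ³`. [folklore] -/
theorem integral_cell_fderiv_eq_zero_real (hL : 0 < L) {g : Space → ℝ} (hg : ContDiff ℝ 1 g)
    (hper : ∀ (x : Space) (k : Fin 3), g (x + EuclideanSpace.single k L) = g x) (j : Fin 3) :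
    ∫ x in cell L, fderiv ℝ g x (EuclideanSpace.single j 1) = 0 := by
  have hψ : ContDiff ℝ 1 (⇑Complex.ofRealCLM ∘ g) := Complex.ofRealCLM.contDiff.comp hg
  have hψper : ∀ (x : Space) (k : Fin 3),
      (⇑Complex.ofRealCLM ∘ g) (x + EuclideanSpace.single k L) = (⇑Complex.ofRealCLM ∘ g) x :=
    fun x k => by simp only [Function.comp_apply, hper]
  have h := integral_cell_fderiv_eq_zero hL hψ hψper j
  have hderiv : ∀ x, fderiv ℝ (⇑Complex.ofRealCLM ∘ g) x (EuclideanSpace.single j 1) =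
      ((fderiv ℝ g x (EuclideanSpace.single j 1) : ℝ) : ℂ) := by
    intro x
    rw [(Complex.ofRealCLM.hasFDerivAt.comp x ((hg.differentiable one_ne_zero) x).hasFDerivAt).fderiv,
      ContinuousLinearMap.comp_apply, Complex.ofRealCLM_apply]
  simp_rw [hderiv] at h
  rw [integral_complex_ofReal] at h
  exact_mod_cast h

/-- **Integration by parts on the `N`-particle torus, boundary form**: for a `C¹` function `G` on
`(ℝ³)^N` that is `Lℤ³`-periodic in every particle, `∫_{[0,L)^{3N}} ∂_{i,k} G dX = 0` (Fubini in
particle `i`, then the one-particle statement `integral_cell_fderiv_eq_zero`: the boundary terms of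
the fundamental theorem of calculus cancel by periodicity). [cite: BakryGentilLedoux2014, §1.11.3 (integration by parts behind (1.11.9))] -/
theorem integral_cellN_pderiv_eq_zero (hL : 0 < L) {G : Config N → ℝ} (hG : ContDiff ℝ 1 G)
    (hper : IsLatticePeriodic L G) (i : Fin N) (k : Fin 3) :
    ∫ X in cellN N L, pderiv i k G X = 0 := by
  cases N with
  | zero => exact i.elim0
  | succ n =>
  have hGd : Differentiable ℝ G := hG.differentiable one_ne_zero
  have hPc : Continuous (pderiv i k G) := continuous_pderiv hG i k
  -- (a) split off particle `i`
  set e := MeasurableEquiv.piFinSuccAbove (fun _ : Fin (n + 1) => Space) i with he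
  have hmp : MeasurePreserving e.symm (volume.prod volume) volume :=
    (volume_preserving_piFinSuccAbove (fun _ : Fin (n + 1) => Space) i).symm
  have hesymm : ∀ z : Space × (Fin n → Space),
      e.symm z = Fin.insertNth (α := fun _ => Space) i z.1 z.2 := by
    intro z
    rw [he, MeasurableEquiv.piFinSuccAbove_symm_apply]
    funext j
    exact Fin.insertNthEquiv_apply _ _ _ _
  have hpre : e.symm ⁻¹' cellN (n + 1) L = cell L ×ˢ cellN n L := by
    ext ⟨x, Y⟩
    simp only [Set.mem_preimage, hesymm, Set.mem_prod, cellN, Set.mem_setOf_eq]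
    rw [Fin.forall_iff_succAbove i]
    simp [Fin.insertNth_apply_same, Fin.insertNth_apply_succAbove]
  have h1 : ∫ X in cellN (n + 1) L, pderiv i k G X =
      ∫ z in cell L ×ˢ cellN n L, pderiv i k G (Fin.insertNth (α := fun _ => Space) i z.1 z.2)
        ∂(volume.prod volume) := by
    rw [← hpre, ← hmp.setIntegral_preimage_emb e.symm.measurableEmbedding]
    simp only [hesymm]
  rw [h1, ← Measure.prod_restrict]
  -- (b) integrability on the product for Fubini
  have hint : Integrable
      (fun z : Space × (Fin n → Space) => pderiv i k G (Fin.insertNth (α := fun _ => Space) i z.1 z.2))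
      ((volume.restrict (cell L)).prod (volume.restrict (cellN n L))) := by
    rw [Measure.prod_restrict, ← hpre]
    have hio : IntegrableOn (pderiv i k G) (cellN (n + 1) L) volume := integrableOn_cellN hPc L
    have h2 := (hmp.integrableOn_comp_preimage e.symm.measurableEmbedding).2 hio
    simpa only [IntegrableOn, Function.comp_def, hesymm] using h2
  rw [integral_prod_symm _ hint]
  -- (c) the inner integral over particle `i` vanishes for every bath configuration `Y`
  refine integral_eq_zero_of_ae (Filter.Eventually.of_forall fun Y => ?_)
  have hg : ContDiff ℝ 1 (fun y : Space => G (Fin.insertNth (α := fun _ => Space) i y Y)) :=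
    hG.comp (contDiff_insertNth i Y)
  have hgper : ∀ (y : Space) (l : Fin 3),
      G (Fin.insertNth (α := fun _ => Space) i (y + EuclideanSpace.single l L) Y) =
        G (Fin.insertNth (α := fun _ => Space) i y Y) := by
    intro y l
    rw [insertNth_add_eq, hper]
  have h0 := integral_cell_fderiv_eq_zero_real hL hg hgper k
  simp_rw [fderiv_slice_apply hGd i k Y] at h0
  exact h0

end Torus

/-! ### Green's identity: the generator and the Dirichlet form -/

section Green

variable {L : ℝ} {F φ ψ g δ : Config N → ℝ}

/-- **Divergence form of the generator, pointwise**: for `φ, F` differentiable at `X`, `ψ ∈ C²`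
and `F(X) ≠ 0`,
`∑_{i,k} ∂_{i,k}(φ F² ∂_{i,k}ψ) = φ (L_F ψ) F² + ∇φ·∇ψ F²` at `X`
(`F² L_F ψ = ∑ ∂(F² ∂ψ)`, Bakry–Gentil–Ledoux (1.11.8) with `w = F²`). [cite: BakryGentilLedoux2014, §1.11.3 (1.11.8)] -/
theorem sum_pderiv_flux_eq {X : Config N} (hφ : DifferentiableAt ℝ φ X) (hF : DifferentiableAt ℝ F X)
    (h0 : F X ≠ 0) (hψ : ContDiff ℝ 2 ψ) :
    ∑ i : Fin N, ∑ k : Fin 3, pderiv i k (fun Y => φ Y * (F Y ^ 2 * pderiv i k ψ Y)) X =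
      φ X * langevinGen F ψ X * F X ^ 2 + gradDot φ ψ X * F X ^ 2 := by
  have hF2 : DifferentiableAt ℝ (fun Y => F Y ^ 2) X := hF.pow 2
  have hterm : ∀ (i : Fin N) (k : Fin 3),
      pderiv i k (fun Y => φ Y * (F Y ^ 2 * pderiv i k ψ Y)) X =
        φ X * (F X ^ 2 * pderiv i k (pderiv i k ψ) X + pderiv i k ψ X * (2 * F X * pderiv i k F X)) +
          F X ^ 2 * pderiv i k ψ X * pderiv i k φ X := by
    intro i k
    have hdψ : DifferentiableAt ℝ (pderiv i k ψ) X := differentiable_pderiv hψ i k X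
    have hprod : DifferentiableAt ℝ (fun Y => F Y ^ 2 * pderiv i k ψ Y) X := hF2.mul hdψ
    rw [pderiv_fun_mul hφ hprod, pderiv_fun_mul hF2 hdψ, pderiv_fun_sq hF]
  simp only [hterm]
  rw [langevinGen_eq_div hF h0, configLaplacian, gradDot, gradDot]
  simp only [Finset.mul_sum, Finset.sum_mul, mul_add, add_mul, ← Finset.sum_add_distrib]
  refine Finset.sum_congr rfl fun i _ => Finset.sum_congr rfl fun k _ => ?_
  field_simp

/-- **Green's identity on the torus** (the generator of the weighted Dirichlet form): for a `C¹`
lattice-periodic nonvanishing weight `F`, a periodic test function `φ` and a `C²` lattice-periodic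
`ψ`, on a cell of side `L > 0`,
`∫_{[0,L)^{3N}} φ (L_F ψ) F² dX = -𝓔_F(φ, ψ)`
(Bakry–Gentil–Ledoux (1.11.9): `∫ f Lg dμ = -∫ Γ(f,g) dμ`; here by `integral_cellN_pderiv_eq_zero`
applied to the fluxes `φ F² ∂_{i,k}ψ`). [cite: BakryGentilLedoux2014, §1.11.3 (1.11.9)] -/
theorem integral_mul_langevinGen_mul_sq (hL : 0 < L) (hF : ContDiff ℝ 1 F)
    (hFper : IsLatticePeriodic L F) (h0 : ∀ X, F X ≠ 0) (hφ : IsPeriodicTest L φ)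
    (hψ : ContDiff ℝ 2 ψ) (hψper : IsLatticePeriodic L ψ) :
    ∫ X in cellN N L, φ X * langevinGen F ψ X * F X ^ 2 = -dirichletFormW L F φ ψ := by
  have hFd : Differentiable ℝ F := hF.differentiable one_ne_zero
  have hφd : Differentiable ℝ φ := hφ.differentiable
  -- the fluxes `G i k = φ F² ∂_{i,k}ψ` are `C¹` and periodic
  set G : Fin N → Fin 3 → Config N → ℝ := fun i k Y => φ Y * (F Y ^ 2 * pderiv i k ψ Y) with hGdef
  have hGc : ∀ i k, ContDiff ℝ 1 (G i k) := fun i k =>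
    hφ.contDiff.mul ((hF.pow 2).mul (contDiff_one_pderiv hψ i k))
  have hGper : ∀ i k, IsLatticePeriodic L (G i k) := fun i k X j l => by
    simp only [hGdef, hφ.periodic X j l, hFper X j l, (hψper.pderiv i k) X j l]
  -- pointwise identity
  have hpt : ∀ X, φ X * langevinGen F ψ X * F X ^ 2 =
      (∑ i : Fin N, ∑ k : Fin 3, pderiv i k (G i k) X) - gradDot φ ψ X * F X ^ 2 := by
    intro X
    rw [sum_pderiv_flux_eq (hφd X) (hFd X) (h0 X) hψ]
    ring
  simp_rw [hpt]
  have hint : ∀ i k, IntegrableOn (pderiv i k (G i k)) (cellN N L) volume := fun i k =>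
    integrableOn_cellN (continuous_pderiv (hGc i k) i k) L
  have hsum : IntegrableOn (fun X => ∑ i : Fin N, ∑ k : Fin 3, pderiv i k (G i k) X) (cellN N L)
      volume :=
    integrable_finsetSum _ fun i _ => integrable_finsetSum _ fun k _ => hint i k
  rw [integral_sub hsum (integrableOn_gradDot_mul_sq hF.continuous hφ.contDiff (hψ.of_le (by norm_num)) L),
    integral_finsetSum _ fun i _ => integrable_finsetSum _ fun k _ => hint i k]
  simp only [integral_finsetSum _ fun k _ => hint _ k,
    integral_cellN_pderiv_eq_zero hL (hGc _ _) (hGper _ _), Finset.sum_const_zero, zero_sub,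
    dirichletFormW]

/-- **Reversibility**: `∫ φ (L_F ψ) F² = ∫ ψ (L_F φ) F²` for `C²` lattice-periodic `φ, ψ`
(`L_F` is symmetric in `L²(F² dX)`, both sides being `-𝓔_F(φ, ψ)`). [cite: BakryGentilLedoux2014, §1.11.3 (after (1.11.8))] -/
theorem integral_mul_langevinGen_symm (hL : 0 < L) (hF : ContDiff ℝ 1 F)
    (hFper : IsLatticePeriodic L F) (h0 : ∀ X, F X ≠ 0) (hφ : ContDiff ℝ 2 φ)
    (hφper : IsLatticePeriodic L φ) (hψ : ContDiff ℝ 2 ψ) (hψper : IsLatticePeriodic L ψ) :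
    ∫ X in cellN N L, φ X * langevinGen F ψ X * F X ^ 2 =
      ∫ X in cellN N L, ψ X * langevinGen F φ X * F X ^ 2 := by
  rw [integral_mul_langevinGen_mul_sq hL hF hFper h0 (hφper.isPeriodicTest (hφ.of_le (by norm_num)))
      hψ hψper,
    integral_mul_langevinGen_mul_sq hL hF hFper h0 (hψper.isPeriodicTest (hψ.of_le (by norm_num)))
      hφ hφper, dirichletFormW_comm]

/-- **Invariance of `μ_F`**: `∫ (L_F ψ) F² dX = 0` for `C²` lattice-periodic `ψ` (Green's identity
with `φ ≡ 1`, constants being `𝓔_F`-null). [cite: BakryGentilLedoux2014, §1.11.3] -/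
theorem integral_langevinGen_mul_sq (hL : 0 < L) (hF : ContDiff ℝ 1 F)
    (hFper : IsLatticePeriodic L F) (h0 : ∀ X, F X ≠ 0) (hψ : ContDiff ℝ 2 ψ)
    (hψper : IsLatticePeriodic L ψ) :
    ∫ X in cellN N L, langevinGen F ψ X * F X ^ 2 = 0 := by
  have h := integral_mul_langevinGen_mul_sq hL hF hFper h0 (IsPeriodicTest.const (N := N) L 1) hψ hψper
  simpa using h

/-- The `μ_F`-mean of `L_F ψ` vanishes. [cite: BakryGentilLedoux2014, §1.11.3] -/
theorem weightedMean_langevinGen (hL : 0 < L) (hF : ContDiff ℝ 1 F)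
    (hFper : IsLatticePeriodic L F) (h0 : ∀ X, F X ≠ 0) (hψ : ContDiff ℝ 2 ψ)
    (hψper : IsLatticePeriodic L ψ) :
    weightedMean L F (langevinGen F ψ) = 0 := by
  rw [weightedMean, integral_langevinGen_mul_sq hL hF hFper h0 hψ hψper, zero_div]

/-- **Strong solutions are weak correctors.** If `δ ∈ C²` is lattice periodic and solves the
Poisson equation `-L_F δ = g` pointwise (for a `C¹` lattice-periodic nonvanishing weight on a cell
of side `L > 0`), then `δ` is a weak corrector of `g`: `𝓔_F(δ, φ) = ∫ g φ F²` for every periodic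
test function `φ` (Green's identity). [cite: BakryGentilLedoux2014, §1.11.3 (1.11.9)] -/
theorem IsWeakCorrector.of_langevinGen (hL : 0 < L) (hF : ContDiff ℝ 1 F)
    (hFper : IsLatticePeriodic L F) (h0 : ∀ X, F X ≠ 0) (hδ : ContDiff ℝ 2 δ)
    (hδper : IsLatticePeriodic L δ) (hg : ∀ X, -langevinGen F δ X = g X) :
    IsWeakCorrector L F g δ := by
  refine ⟨hδper.isPeriodicTest (hδ.of_le (by norm_num)), fun φ hφ => ?_⟩
  rw [dirichletFormW_comm, ← neg_neg (dirichletFormW L F φ δ),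
    ← integral_mul_langevinGen_mul_sq hL hF hFper h0 hφ hδ hδper, ← integral_neg]
  refine integral_congr_ae (Filter.Eventually.of_forall fun X => ?_)
  simp only [← hg X]
  ring

/-- With a strong corrector the `H₋₁` norm is the explicit integral `‖g‖²₋₁ = ∫ g δ F² = 𝓔_F(δ, δ)`.
[cite: KipnisLandim1999, App. 1 §6] -/
theorem hMinusOneSqW_eq_of_langevinGen (hL : 0 < L) (hF : ContDiff ℝ 1 F)
    (hFper : IsLatticePeriodic L F) (h0 : ∀ X, F X ≠ 0) (hδ : ContDiff ℝ 2 δ)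
    (hδper : IsLatticePeriodic L δ) (hg : ∀ X, -langevinGen F δ X = g X) :
    hMinusOneSqW L F g = ENNReal.ofReal (∫ X in cellN N L, g X * δ X * F X ^ 2) :=
  (IsWeakCorrector.of_langevinGen hL hF hFper h0 hδ hδper hg).hMinusOneSqW_eq hF.continuous

end Green

/-! ### Weak correctors with smooth data are strong solutions -/

section WeakToStrong

variable {L : ℝ} {F g δ φ : Config N → ℝ}

/-- For `φ ∈ C³`, `∂_{i,k}φ ∈ C²`. [folklore] -/
theorem contDiff_two_pderiv (hφ : ContDiff ℝ 3 φ) (i : Fin N) (k : Fin 3) :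
    ContDiff ℝ 2 (pderiv i k φ) :=
  (hφ.fderiv_right (m := 2) (by norm_num)).clm_apply contDiff_const

/-- `L_F δ` is continuous for `F ∈ C¹` nonvanishing and `δ ∈ C²`. [folklore] -/
theorem continuous_langevinGen (hF : ContDiff ℝ 1 F) (h0 : ∀ X, F X ≠ 0) (hδ : ContDiff ℝ 2 δ) :
    Continuous (langevinGen F δ) := by
  have hlog : ContDiff ℝ 1 (fun Y => Real.log (F Y)) := hF.log h0
  show Continuous (fun X => (∑ i, ∑ k, pderiv i k (pderiv i k δ) X) +
      2 * ∑ i, ∑ k, pderiv i k (fun Y => Real.log (F Y)) X * pderiv i k δ X)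
  exact (continuous_finsetSum _ fun i _ => continuous_finsetSum _ fun k _ =>
      continuous_pderiv (contDiff_one_pderiv hδ i k) i k).add
    (continuous_const.mul (continuous_finsetSum _ fun i _ => continuous_finsetSum _ fun k _ =>
      (continuous_pderiv hlog i k).mul (continuous_pderiv (hδ.of_le (by norm_num)) i k)))

/-- `L_F δ ∈ C¹` for `F ∈ C²` nonvanishing and `δ ∈ C³`. [folklore] -/
theorem contDiff_one_langevinGen (hF : ContDiff ℝ 2 F) (h0 : ∀ X, F X ≠ 0) (hδ : ContDiff ℝ 3 δ) :
    ContDiff ℝ 1 (langevinGen F δ) := by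
  have hlog : ContDiff ℝ 2 (fun Y => Real.log (F Y)) := hF.log h0
  show ContDiff ℝ 1 (fun X => (∑ i, ∑ k, pderiv i k (pderiv i k δ) X) +
      2 * ∑ i, ∑ k, pderiv i k (fun Y => Real.log (F Y)) X * pderiv i k δ X)
  refine (ContDiff.sum fun i _ => ContDiff.sum fun k _ => ?_).add
    (contDiff_const.mul (ContDiff.sum fun i _ => ContDiff.sum fun k _ => ?_))
  · exact contDiff_one_pderiv (contDiff_two_pderiv hδ i k) i k
  · exact (contDiff_one_pderiv hlog i k).mul ((contDiff_two_pderiv hδ i k).of_le (by norm_num))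

/-- `L_F δ` is lattice periodic when `F` and `δ` are. [folklore] -/
theorem IsLatticePeriodic.langevinGen (hFper : IsLatticePeriodic L F) (hδper : IsLatticePeriodic L δ) :
    IsLatticePeriodic L (langevinGen F δ) := by
  intro X j l
  have h1 : ∀ (i : Fin N) (k : Fin 3),
      BoseGas.pderiv i k (BoseGas.pderiv i k δ) (X + Pi.single j (EuclideanSpace.single l L)) =
        BoseGas.pderiv i k (BoseGas.pderiv i k δ) X :=
    fun i k => ((hδper.pderiv i k).pderiv i k) X j l
  have h2 : ∀ (i : Fin N) (k : Fin 3),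
      BoseGas.pderiv i k (fun Y => Real.log (F Y)) (X + Pi.single j (EuclideanSpace.single l L)) =
        BoseGas.pderiv i k (fun Y => Real.log (F Y)) X :=
    fun i k => ((hFper.comp Real.log).pderiv i k) X j l
  have h3 : ∀ (i : Fin N) (k : Fin 3),
      BoseGas.pderiv i k δ (X + Pi.single j (EuclideanSpace.single l L)) = BoseGas.pderiv i k δ X :=
    fun i k => (hδper.pderiv i k) X j l
  simp only [BoseGas.langevinGen, configLaplacian, gradDot, h1, h2, h3]

/-- **Orthogonality of the residual.** If `δ ∈ C²` is a weak corrector of `g` (continuous) for a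
`C¹` lattice-periodic nonvanishing weight on a cell of side `L > 0`, then the residual
`r = L_F δ + g` of the Poisson equation is `F² dX`-orthogonal to every periodic test function:
`∫ φ r F² = 0` (Green's identity turns `𝓔_F(δ, φ)` into `-∫ φ L_F δ F²`). [cite: BakryGentilLedoux2014, §1.11.3 (1.11.9)] -/
theorem IsWeakCorrector.integral_mul_residual_mul_sq (h : IsWeakCorrector L F g δ) (hL : 0 < L)
    (hF : ContDiff ℝ 1 F) (hFper : IsLatticePeriodic L F) (h0 : ∀ X, F X ≠ 0)
    (hδ : ContDiff ℝ 2 δ) (hg : Continuous g) (hφ : IsPeriodicTest L φ) :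
    ∫ X in cellN N L, φ X * (langevinGen F δ X + g X) * F X ^ 2 = 0 := by
  have hδper : IsLatticePeriodic L δ := h.isPeriodicTest.isLatticePeriodic
  have hGreen := integral_mul_langevinGen_mul_sq hL hF hFper h0 hφ hδ hδper
  have hweak : dirichletFormW L F δ φ = ∫ X in cellN N L, φ X * g X * F X ^ 2 := by
    rw [h.dirichletFormW_eq hφ]
    exact integral_congr_ae (Filter.Eventually.of_forall fun X => by ring)
  have hi1 : IntegrableOn (fun X => φ X * langevinGen F δ X * F X ^ 2) (cellN N L) volume :=
    integrableOn_cellN ((hφ.continuous.mul (continuous_langevinGen hF h0 hδ)).mul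
      (hF.continuous.pow 2)) L
  have hi2 : IntegrableOn (fun X => φ X * g X * F X ^ 2) (cellN N L) volume :=
    integrableOn_cellN ((hφ.continuous.mul hg).mul (hF.continuous.pow 2)) L
  calc ∫ X in cellN N L, φ X * (langevinGen F δ X + g X) * F X ^ 2
      = ∫ X in cellN N L, (φ X * langevinGen F δ X * F X ^ 2 + φ X * g X * F X ^ 2) :=
        integral_congr_ae (Filter.Eventually.of_forall fun X => by ring)
    _ = -dirichletFormW L F φ δ + dirichletFormW L F δ φ := by rw [integral_add hi1 hi2, hGreen, hweak]
    _ = 0 := by rw [dirichletFormW_comm]; ring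

/-- **Weak correctors with smooth data solve the Poisson equation on the open box.** If `δ` is a
weak corrector of `g` for the weight `F` on a cell of side `L > 0`, with `F ∈ C²` lattice periodic
and nonvanishing, `δ ∈ C³`, and `g ∈ C¹` lattice periodic, then `-L_F δ = g` on the open box
`(0,L)^{3N}`. (The residual `r = L_F δ + g` is then itself a periodic test function; testing its
orthogonality against `φ = r` gives `∫ r² F² = 0` on the cell, and a continuous nonnegative
function with vanishing integral vanishes on every open subset, Lebesgue measure charging open
sets — du Bois-Reymond on the torus.) [folklore] -/
theorem IsWeakCorrector.neg_langevinGen_eq_of_mem_boxN (h : IsWeakCorrector L F g δ) (hL : 0 < L)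
    (hF : ContDiff ℝ 2 F) (hFper : IsLatticePeriodic L F) (h0 : ∀ X, F X ≠ 0)
    (hδ : ContDiff ℝ 3 δ) (hg : ContDiff ℝ 1 g) (hgper : IsLatticePeriodic L g)
    {X : Config N} (hX : X ∈ boxN N L) : -langevinGen F δ X = g X := by
  have hδper : IsLatticePeriodic L δ := h.isPeriodicTest.isLatticePeriodic
  have hF1 : ContDiff ℝ 1 F := hF.of_le (by norm_num)
  -- the residual is a periodic test function
  have hrC : ContDiff ℝ 1 (fun Y => langevinGen F δ Y + g Y) :=
    (contDiff_one_langevinGen hF h0 hδ).add hg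
  have hrper : IsLatticePeriodic L (fun Y => langevinGen F δ Y + g Y) :=
    fun Y j l => ((hFper.langevinGen hδper).add hgper) Y j l
  have hrtest : IsPeriodicTest L (fun Y => langevinGen F δ Y + g Y) := hrper.isPeriodicTest hrC
  -- `∫ r² F² = 0`
  have hint0 := h.integral_mul_residual_mul_sq hL hF1 hFper h0 (hδ.of_le (by norm_num))
    hg.continuous hrtest
  -- the integrand `H = r² F²` is continuous, nonnegative, with vanishing integral on the cell
  set H : Config N → ℝ := fun Y =>
    (langevinGen F δ Y + g Y) * (langevinGen F δ Y + g Y) * F Y ^ 2 with hH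
  have hHc : Continuous H := (hrC.continuous.mul hrC.continuous).mul (hF.continuous.pow 2)
  have hHnn : ∀ Y, 0 ≤ H Y := fun Y => mul_nonneg (mul_self_nonneg _) (sq_nonneg _)
  have hHint : IntegrableOn H (cellN N L) volume := integrableOn_cellN hHc L
  by_contra hne
  have hrX : langevinGen F δ X + g X ≠ 0 := fun h0' => hne (by linarith)
  have hHX : 0 < H X := mul_pos (mul_self_pos.2 hrX) (sq_pos_iff.2 (h0 X))
  -- an open neighbourhood of `X` inside the cell on which `H > 0`
  have hbox : IsOpen (boxN N L) := by
    have hb : boxN N L = ⋂ i : Fin N, ⋂ k : Fin 3, (fun Y : Config N => Y i k) ⁻¹' Set.Ioo 0 L := by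
      ext Y; simp [boxN, box]
    rw [hb]
    exact isOpen_iInter_of_finite fun i => isOpen_iInter_of_finite fun k =>
      isOpen_Ioo.preimage (by fun_prop)
  have hU : IsOpen (boxN N L ∩ H ⁻¹' Set.Ioi 0) := hbox.inter (isOpen_Ioi.preimage hHc)
  have hUpos : 0 < volume (boxN N L ∩ H ⁻¹' Set.Ioi 0) := hU.measure_pos volume ⟨X, hX, hHX⟩
  have hsub : boxN N L ∩ H ⁻¹' Set.Ioi 0 ⊆ Function.support H ∩ cellN N L := fun Y hY =>
    ⟨(hY.2 : 0 < H Y).ne', fun i k => Set.Ioo_subset_Ico_self (hY.1 i k)⟩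
  have hpos : 0 < ∫ Y in cellN N L, H Y := by
    rw [setIntegral_pos_iff_support_of_nonneg_ae (Filter.Eventually.of_forall hHnn) hHint]
    exact hUpos.trans_le (measure_mono hsub)
  exact hpos.ne' hint0

/-- **Weak correctors with smooth data solve the Poisson equation on the fundamental cell**
`[0,L)^{3N}` (the open-box statement extended to the faces by continuity along
`t ↦ X + t(1, …, 1)`, which enters the open box for small `t > 0`); with lattice periodicity of both
sides this is the pointwise equation `-L_F δ = g` everywhere. [folklore] -/
theorem IsWeakCorrector.neg_langevinGen_eq (h : IsWeakCorrector L F g δ) (hL : 0 < L)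
    (hF : ContDiff ℝ 2 F) (hFper : IsLatticePeriodic L F) (h0 : ∀ X, F X ≠ 0)
    (hδ : ContDiff ℝ 3 δ) (hg : ContDiff ℝ 1 g) (hgper : IsLatticePeriodic L g)
    {X : Config N} (hX : X ∈ cellN N L) : -langevinGen F δ X = g X := by
  set E1 : Config N := fun _ => (WithLp.toLp 2 fun _ : Fin 3 => (1 : ℝ) : Space) with hE1
  set r : ℝ → ℝ := fun t => langevinGen F δ (X + t • E1) + g (X + t • E1) with hr
  have hcoord : ∀ (t : ℝ) (i : Fin N) (k : Fin 3), (X + t • E1) i k = X i k + t := by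
    intro t i k
    simp [hE1]
  -- for small `t > 0` the shifted configuration lies in the open box
  have hev : ∀ᶠ t in nhdsWithin (0 : ℝ) (Set.Ioi 0), X + t • E1 ∈ boxN N L := by
    have h1 : ∀ (i : Fin N) (k : Fin 3), ∀ᶠ t in nhdsWithin (0 : ℝ) (Set.Ioi 0),
        X i k + t ∈ Set.Ioo 0 L := by
      intro i k
      have hIco : X i k ∈ Set.Ico 0 L := hX i k
      have hpos : ∀ᶠ t in nhdsWithin (0 : ℝ) (Set.Ioi 0), t ∈ Set.Ioi 0 := self_mem_nhdsWithin
      have hsmall : ∀ᶠ t in nhdsWithin (0 : ℝ) (Set.Ioi 0), t < L - X i k :=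
        nhdsWithin_le_nhds (eventually_lt_nhds (by linarith [hIco.2]))
      filter_upwards [hpos, hsmall] with t ht1 ht2
      exact ⟨by linarith [hIco.1, Set.mem_Ioi.1 ht1], by linarith⟩
    have h2 : ∀ᶠ t in nhdsWithin (0 : ℝ) (Set.Ioi 0), ∀ i k, X i k + t ∈ Set.Ioo 0 L :=
      Filter.eventually_all.2 fun i => Filter.eventually_all.2 fun k => h1 i k
    filter_upwards [h2] with t ht
    intro i k
    rw [hcoord]
    exact ht i k
  -- there the residual vanishes
  have hzero : ∀ᶠ t in nhdsWithin (0 : ℝ) (Set.Ioi 0), r t = 0 := by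
    filter_upwards [hev] with t ht
    have := h.neg_langevinGen_eq_of_mem_boxN hL hF hFper h0 hδ hg hgper ht
    simp only [hr]
    linarith
  -- continuity of the residual along the segment
  have hcont : Continuous r :=
    ((continuous_langevinGen (hF.of_le (by norm_num)) h0 (hδ.of_le (by norm_num))).add
      hg.continuous).comp (continuous_const.add (continuous_id.smul continuous_const))
  have hlim : Filter.Tendsto r (nhdsWithin (0 : ℝ) (Set.Ioi 0)) (nhds (r 0)) :=
    tendsto_nhdsWithin_of_tendsto_nhds hcont.continuousAt
  have hlim0 : Filter.Tendsto r (nhdsWithin (0 : ℝ) (Set.Ioi 0)) (nhds 0) :=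
    tendsto_const_nhds.congr' (hzero.mono fun t ht => ht.symm)
  have hr0 : r 0 = 0 := tendsto_nhds_unique hlim hlim0
  simp only [hr, zero_smul, add_zero] at hr0
  linarith

end WeakToStrong

end Literature.MathematicalPhysics.QuantumManyBody.BoseGas

end
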